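import Summits.Ventures.WeilGRH.TwistedBonusSech
import Literature.NumberTheory.LFunctions.WeilArchimedeanMoments
import Literature.NumberTheory.LFunctions.WeilGroundEnergyProofs
import Literature.NumberTheory.LFunctions.WeilArchimedeanPositivityProofs
import Mathlib.Analysis.Convolution
import HarnessLib

/-!
# Twisted moment certificates, odd characters (II): the parity bonus in the moments of the test function

Cell `rh-explicit`, WEIL TRACK — GRH ARM (namespace `Summit.Ventures.WeilGRH`).  For `k = g ⋆ g̃` with
`tsupport g ⊆ [−a, a]`, the parity-bonus functional of an odd character,
`∫ k(w) dw/(2cosh(w/2))` (`= (1/2π)∫|ĝ(1/2+iτ)|² π sech(πτ) dτ`, `WeilExplicitArchParitySech.lean`), is expanded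
in the scaled moments `M_i = ∫ g(x)(x/a)^i dx` (`weilMoment`):

* `integral_weilConv_weilReflect_mul_pow` — `∫ k(w) w^m dw = Σ_{i ≤ m} C(m,i) (∫ g u^i)(∫ g̃ v^{m−i})`
  (binomial theorem under the convolution integral, then `MeasureTheory.integral_convolution`);
  `integral_weilReflect_mul_pow` — `∫ g̃(v) v^j dv = (−1)^j conj ∫ g(x) x^j dx`;
* `sum_range_sq_eq_sum_antidiag` — the re-indexing `Σ_{k,l<n} F(k,l) = Σ_{m<len} Σ_{k≤m} F(k, m−k)` for `F`
  vanishing on `k + l ≥ len`, `len ≤ n`;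
* **`re_integral_weilConv_weilReflect_sech_ge`** — with `P = polyR pc` (`pc.length ≤ n`) and
  `ε = epsSechQ pc nn a` (`TwistedBonusSech.lean`):
  `Σ_{k,l<n} bonCoeff pc a k l · Re(conj M_k · M_l) − 2aε‖g‖₂² ≤ Re ∫ k(w)/(2cosh(w/2)) dw`,
  `bonCoeff pc a k l = pc_{k+l} C(k+l,k) (−1)^l a^{k+l} / 2^{k+l+1}` — the bonus enters the certificate's
  moment matrix EXACTLY (a Hankel-type shift of the moment table, `TwistedMomentCertOdd.lean`) at the price
  `2aε` on the coefficient of `‖g‖₂²` (`|k| ≤ ‖g‖₂²`, `k = 0` off `[−2a, 2a]`, `|sech − P| ≤ ε` there).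

Everything here is PROVED; no named facts.

## References

* A. Weil, *Sur les "formules explicites" de la théorie des nombres premiers* (1952), (10)–(11) (the kernels
  `K_{1,0}`, `K_{1,1}` of a real place; their difference is the `sech` kernel).
* E. Bombieri, *Remarks on Weil's quadratic functional…* I (2000), §4 Lemma 2 (`|g ⋆ g̃| ≤ ‖g‖₂²`).
-/

noncomputable section

open Complex Finset MeasureTheory Set Filter
open scoped Real Topology ComplexConjugate BigOperators Convolution

namespace Summit.Ventures.WeilGRH

open Literature.NumberTheory.LFunctions
open Literature.Analysis.ValidatedNumerics.Numerics

variable {g : ℝ → ℂ}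

/-! ## Moments of `g̃` and of `g ⋆ g̃` -/

/-- `∫ g(x) x^i dx = a^i · M_i` (`M_i = weilMoment a g i = ∫ g(x)(x/a)^i dx`, `a ≠ 0`). [folklore] -/
theorem integral_mul_pow_eq_weilMoment (g : ℝ → ℂ) {a : ℝ} (ha : a ≠ 0) (i : ℕ) :
    ∫ x : ℝ, g x * ((x ^ i : ℝ) : ℂ) = (a : ℂ) ^ i * weilMoment a g i := by
  unfold weilMoment
  rw [← integral_const_mul]
  refine integral_congr_ae (Eventually.of_forall fun x ↦ ?_)
  simp only
  have ha' : (a : ℂ) ^ i ≠ 0 := pow_ne_zero _ (by exact_mod_cast ha)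
  rw [div_pow]
  push_cast
  field_simp

/-- `∫ g̃(v) v^j dv = (−1)^j · conj ∫ g(x) x^j dx` (`g̃(v) = conj g(−v)`). [folklore] -/
theorem integral_weilReflect_mul_pow (g : ℝ → ℂ) (j : ℕ) :
    ∫ v : ℝ, weilReflect g v * ((v ^ j : ℝ) : ℂ) = (-1) ^ j * conj (∫ x : ℝ, g x * ((x ^ j : ℝ) : ℂ)) := by
  have h := integral_neg_eq_self (fun x : ℝ ↦ conj (g x) * (((-x) ^ j : ℝ) : ℂ)) volume
  simp only [neg_neg] at h
  unfold weilReflect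
  rw [h, ← integral_conj, ← integral_const_mul]
  refine integral_congr_ae (Eventually.of_forall fun x ↦ ?_)
  simp only [map_mul, Complex.conj_ofReal]
  rw [neg_pow]
  push_cast
  ring

/-- Continuity of `g̃`. [folklore] -/
theorem continuous_weilReflect (hg : IsWeilTest g) : Continuous (weilReflect g) :=
  hg.weilReflect.1.continuous

/-- **Moments of `k = g ⋆ g̃`**: `∫ k(w) w^m dw = Σ_{i ≤ m} C(m,i) (∫ g u^i du)(∫ g̃ v^{m−i} dv)`. [folklore] -/
theorem integral_weilConv_weilReflect_mul_pow (hg : IsWeilTest g) (m : ℕ) :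
    ∫ w : ℝ, weilConv g (weilReflect g) w * ((w ^ m : ℝ) : ℂ) =
      ∑ i ∈ range (m + 1), (m.choose i : ℂ) *
        ((∫ u : ℝ, g u * ((u ^ i : ℝ) : ℂ)) * ∫ v : ℝ, weilReflect g v * ((v ^ (m - i) : ℝ) : ℂ)) := by
  have hgc : Continuous g := hg.1.continuous
  have hrc : Continuous (weilReflect g) := continuous_weilReflect hg
  have hgs : HasCompactSupport g := hg.2
  have hrs : HasCompactSupport (weilReflect g) := hg.weilReflect.2
  -- the factors `f_i(u) = g(u) u^i`, `h_j(v) = g̃(v) v^j`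
  set f : ℕ → ℝ → ℂ := fun i u ↦ g u * ((u ^ i : ℝ) : ℂ) with hf
  set h : ℕ → ℝ → ℂ := fun j v ↦ weilReflect g v * ((v ^ j : ℝ) : ℂ) with hh
  have hfc : ∀ i, Continuous (f i) := fun i ↦ hgc.mul (by fun_prop)
  have hhc : ∀ j, Continuous (h j) := fun j ↦ hrc.mul (by fun_prop)
  have hfs : ∀ i, HasCompactSupport (f i) := fun i ↦ hgs.mul_right
  have hhs : ∀ j, HasCompactSupport (h j) := fun j ↦ hrs.mul_right
  have hfi : ∀ i, Integrable (f i) := fun i ↦ (hfc i).integrable_of_hasCompactSupport (hfs i)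
  have hhi : ∀ j, Integrable (h j) := fun j ↦ (hhc j).integrable_of_hasCompactSupport (hhs j)
  -- pointwise: `k(w) w^m = Σ_i C(m,i) (f_i ⋆ h_{m-i})(w)`
  have hpt : ∀ w : ℝ, weilConv g (weilReflect g) w * ((w ^ m : ℝ) : ℂ) =
      ∑ i ∈ range (m + 1), (m.choose i : ℂ) * weilConv (f i) (h (m - i)) w := by
    intro w
    rw [weilConv_apply, ← integral_mul_const]
    have hint : ∀ i ∈ range (m + 1), Integrable fun u : ℝ ↦ (m.choose i : ℂ) * (f i u * h (m - i) (w - u)) := by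
      intro i _
      refine ((continuous_const.mul ((hfc i).mul ((hhc (m - i)).comp (continuous_const.sub continuous_id)))).integrable_of_hasCompactSupport ?_)
      exact ((hfs i).mul_right).mul_left
    simp_rw [weilConv_apply, ← integral_const_mul]
    rw [← integral_finsetSum _ hint]
    refine integral_congr_ae (Eventually.of_forall fun u ↦ ?_)
    simp only [hf, hh]
    have hbin : ((w ^ m : ℝ) : ℂ) = ∑ i ∈ range (m + 1), (u : ℂ) ^ i * ((w : ℂ) - u) ^ (m - i) * (m.choose i : ℂ) := by
      have := add_pow (u : ℂ) ((w : ℂ) - u) m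
      rw [add_sub_cancel] at this
      push_cast
      exact this
    rw [hbin, Finset.mul_sum]
    refine Finset.sum_congr rfl fun i _ ↦ ?_
    push_cast
    ring
  simp_rw [hpt]
  have hci : ∀ i, Integrable (fun w ↦ (m.choose i : ℂ) * weilConv (f i) (h (m - i)) w) := fun i ↦ by
    refine Integrable.const_mul ?_ _
    unfold weilConv
    exact (hfi i).integrable_convolution _ (hhi (m - i))
  rw [integral_finsetSum _ fun i _ ↦ hci i]
  refine Finset.sum_congr rfl fun i _ ↦ ?_
  rw [integral_const_mul]
  congr 1
  unfold weilConv
  rw [integral_convolution (L := ContinuousLinearMap.mul ℂ ℂ) (hfi i) (hhi (m - i))]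
  simp [ContinuousLinearMap.mul_apply', hf, hh]

/-! ## Re-indexing a double sum along anti-diagonals -/

/-- `Σ_{k<n} Σ_{l<n} F k l = Σ_{m<len} Σ_{k≤m} F k (m−k)` when `F` vanishes for `k + l ≥ len` and `len ≤ n`. [folklore] -/
theorem sum_range_sq_eq_sum_antidiag {α : Type*} [AddCommMonoid α] (F : ℕ → ℕ → α) {len n : ℕ}
    (hlen : len ≤ n) (hF : ∀ k l, len ≤ k + l → F k l = 0) :
    ∑ k ∈ range n, ∑ l ∈ range n, F k l = ∑ m ∈ range len, ∑ k ∈ range (m + 1), F k (m - k) := by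
  -- insert `F k l = Σ_{m<len} [m = k + l] F k l`
  have h1 : ∀ k l, F k l = ∑ m ∈ range len, if m = k + l then F k l else 0 := by
    intro k l
    by_cases hkl : k + l < len
    · rw [Finset.sum_ite_eq' (range len) (k + l) (fun _ ↦ F k l), if_pos (Finset.mem_range.2 hkl)]
    · push Not at hkl
      rw [hF k l hkl]
      exact (Finset.sum_eq_zero fun m hm ↦ by
        rw [if_neg]; exact fun h ↦ by rw [h] at hm; exact absurd (Finset.mem_range.1 hm) (not_lt.2 hkl)).symm
  have h2 : ∑ k ∈ range n, ∑ l ∈ range n, F k l =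
      ∑ m ∈ range len, ∑ k ∈ range n, ∑ l ∈ range n, if m = k + l then F k l else 0 := by
    calc ∑ k ∈ range n, ∑ l ∈ range n, F k l
        = ∑ k ∈ range n, ∑ l ∈ range n, ∑ m ∈ range len, (if m = k + l then F k l else 0) :=
          Finset.sum_congr rfl fun k _ ↦ Finset.sum_congr rfl fun l _ ↦ h1 k l
      _ = ∑ k ∈ range n, ∑ m ∈ range len, ∑ l ∈ range n, (if m = k + l then F k l else 0) :=
          Finset.sum_congr rfl fun k _ ↦ Finset.sum_comm
      _ = ∑ m ∈ range len, ∑ k ∈ range n, ∑ l ∈ range n, (if m = k + l then F k l else 0) :=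
          Finset.sum_comm
  rw [h2]
  refine Finset.sum_congr rfl fun m hm ↦ ?_
  have hm' : m < len := Finset.mem_range.1 hm
  -- inner: for fixed `m`, `Σ_{k<n} Σ_{l<n} [m = k+l] F k l = Σ_{k ≤ m} F k (m - k)`
  have h3 : ∀ k ∈ range n, (∑ l ∈ range n, if m = k + l then F k l else 0) =
      if k ≤ m then F k (m - k) else 0 := by
    intro k _
    by_cases hkm : k ≤ m
    · rw [if_pos hkm]
      have e : ∀ l ∈ range n, (if m = k + l then F k l else 0) = if l = m - k then F k l else 0 := by
        intro l _
        by_cases hl : l = m - k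
        · rw [if_pos hl, if_pos (by omega)]
        · rw [if_neg hl, if_neg (by omega)]
      rw [Finset.sum_congr rfl e, Finset.sum_ite_eq' (range n) (m - k) (fun l ↦ F k l),
        if_pos (Finset.mem_range.2 (by omega))]
    · rw [if_neg hkm]
      exact Finset.sum_eq_zero fun l _ ↦ by rw [if_neg (by omega)]
  rw [Finset.sum_congr rfl h3]
  have h4 : ∑ k ∈ range n, (if k ≤ m then F k (m - k) else 0) =
      ∑ k ∈ range (m + 1), (if k ≤ m then F k (m - k) else 0) := by
    refine (Finset.sum_subset (Finset.range_subset_range.2 (by omega)) fun k _ hk ↦ ?_).symm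
    rw [if_neg]
    intro hkm
    exact hk (Finset.mem_range.2 (by omega))
  rw [h4]
  exact Finset.sum_congr rfl fun k hk ↦ by rw [if_pos (by have := Finset.mem_range.1 hk; omega)]

/-! ## The bonus in the moments -/

/-- The bonus matrix entry `pc_{k+l} C(k+l,k) (−1)^l a^{k+l} / 2^{k+l+1}`. [folklore] -/
def bonCoeff (pc : List ℚ) (a : ℝ) (k l : ℕ) : ℝ :=
  ((getV pc (k + l) : ℚ) : ℝ) / 2 ^ (k + l + 1) * ((k + l).choose k : ℝ) * (-1) ^ l * a ^ (k + l)

/-- `getV` beyond the length is `0`. [folklore] -/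
theorem getV_eq_zero_of_length_le {v : List ℚ} {i : ℕ} (h : v.length ≤ i) : getV v i = 0 := by
  unfold getV
  rw [List.getD_eq_getElem?_getD, List.getElem?_eq_none_iff.2 h, Option.getD_none]

/-- `polyR pc (w/2) / 2` as a complex polynomial in `w`. [folklore] -/
theorem half_polyR_half_cast (pc : List ℚ) (w : ℝ) :
    (((polyR pc (w / 2)) / 2 : ℝ) : ℂ) =
      ∑ j ∈ range pc.length, (((getV pc j : ℚ) : ℝ) / 2 ^ (j + 1) : ℝ) * ((w ^ j : ℝ) : ℂ) := by
  unfold polyR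
  rw [Finset.sum_div]
  push_cast
  refine Finset.sum_congr rfl fun j _ ↦ ?_
  rw [div_pow, pow_succ]
  field_simp

/-- **The parity bonus in the moments.** For a test function `g` with `tsupport g ⊆ [−a, a]`
(`0 < a ≤ 1` rational), a coefficient list `pc` of length `≤ n`, and `nn ≥ 1`:
`Σ_{k,l<n} bonCoeff pc a k l · Re(conj M_k · M_l) − 2a·ε·‖g‖₂² ≤ Re ∫ (g ⋆ g̃)(w) dw/(2cosh(w/2))`,
`ε = epsSechQ pc nn a`. [folklore] -/
theorem re_integral_weilConv_weilReflect_sech_ge (hg : IsWeilTest g) {aQ : ℚ} (ha0 : 0 < aQ) (ha1 : aQ ≤ 1)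
    (hsupp : tsupport g ⊆ Icc (-(aQ : ℝ)) aQ) (pc : List ℚ) {n : ℕ} (hn : pc.length ≤ n)
    {nn : ℕ} (hnn : 0 < nn) :
    ∑ k ∈ range n, ∑ l ∈ range n,
          bonCoeff pc aQ k l * (conj (weilMoment aQ g k) * weilMoment aQ g l).re -
        2 * aQ * (epsSechQ pc nn aQ : ℝ) * weilNorm2Sq g ≤
      (∫ w : ℝ, weilConv g (weilReflect g) w * (((1 / (2 * Real.cosh (w / 2)) : ℝ) : ℂ))).re := by
  set a : ℝ := (aQ : ℝ) with ha_def
  have ha : 0 < a := by rw [ha_def]; exact_mod_cast ha0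
  have hane : a ≠ 0 := ha.ne'
  set kf : ℝ → ℂ := weilConv g (weilReflect g) with hkf
  set ε : ℝ := ((epsSechQ pc nn aQ : ℚ) : ℝ) with hε
  set N2 : ℝ := weilNorm2Sq g with hN2
  set M : ℕ → ℂ := weilMoment a g with hM
  have hk : IsWeilTest kf := hg.weilConv hg.weilReflect
  have hkc : Continuous kf := hk.1.continuous
  have hks : tsupport kf ⊆ Icc (-(2 * a)) (2 * a) := tsupport_weilConv_weilReflect_subset hg.2 hsupp
  have hkN2 : ∀ w, ‖kf w‖ ≤ N2 := fun w ↦ norm_weilConv_weilReflect_le hg w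
  have hε0 : 0 ≤ ε := by rw [hε]; exact_mod_cast epsSechQ_nonneg pc nn ha0.le
  have hN20 : 0 ≤ N2 := weilNorm2Sq_nonneg g
  -- split the kernel `1/(2cosh(w/2)) = polyR pc (w/2)/2 + r(w)`
  set r : ℝ → ℝ := fun w ↦ 1 / (2 * Real.cosh (w / 2)) - polyR pc (w / 2) / 2 with hr
  have hrb : ∀ w ∈ Icc (-(2 * a)) (2 * a), |r w| ≤ ε / 2 := by
    intro w hw
    have hz : |w / 2| ≤ (aQ : ℝ) := by
      rw [abs_div, abs_two, div_le_iff₀ (by norm_num : (0:ℝ) < 2)]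
      rw [← ha_def]
      exact abs_le.2 ⟨by linarith [hw.1], by linarith [hw.2]⟩
    have h := abs_inv_cosh_sub_polyR_le pc hnn ha0.le ha1 hz
    have e : r w = (1 / Real.cosh (w / 2) - polyR pc (w / 2)) / 2 := by
      rw [hr]; simp only; ring
    rw [e, abs_div, abs_two]
    linarith
  -- (A) the remainder integral
  have hkz : ∀ w, w ∉ Icc (-(2 * a)) (2 * a) → kf w = 0 :=
    fun w hw ↦ image_eq_zero_of_notMem_tsupport fun h ↦ hw (hks h)
  have hrm : Measurable r := by
    rw [hr]
    refine Measurable.sub (by fun_prop) ?_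
    refine Measurable.div_const ?_ _
    unfold polyR
    fun_prop
  set C : ℝ := N2 * (ε / 2) with hC
  have hdom : ∀ w, ‖kf w * ((r w : ℝ) : ℂ)‖ ≤ Set.indicator (Icc (-(2 * a)) (2 * a)) (fun _ ↦ C) w := by
    intro w
    by_cases hw : w ∈ Icc (-(2 * a)) (2 * a)
    · rw [Set.indicator_of_mem hw, norm_mul, Complex.norm_real, Real.norm_eq_abs, hC]
      exact mul_le_mul (hkN2 w) (hrb w hw) (abs_nonneg _) hN20
    · rw [Set.indicator_of_notMem hw, hkz w hw, zero_mul, norm_zero]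
  have hIcc : MeasurableSet (Icc (-(2 * a)) (2 * a)) := measurableSet_Icc
  have hindi : Integrable (Set.indicator (Icc (-(2 * a)) (2 * a)) (fun _ : ℝ ↦ C)) :=
    (integrable_indicator_iff hIcc).2 (integrableOn_const measure_Icc_lt_top.ne)
  have hA : ‖∫ w : ℝ, kf w * ((r w : ℝ) : ℂ)‖ ≤ 2 * a * ε * N2 := by
    refine (norm_integral_le_of_norm_le hindi (Eventually.of_forall hdom)).trans ?_
    rw [integral_indicator_const _ hIcc, Real.volume_real_Icc_of_le (by linarith), smul_eq_mul, hC]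
    have : (2 * a - -(2 * a)) * (N2 * (ε / 2)) = 2 * a * ε * N2 := by ring
    rw [this]
  -- (B) the polynomial part
  have hkpow : ∀ j, Integrable fun w : ℝ ↦ kf w * ((w ^ j : ℝ) : ℂ) :=
    fun j ↦ (hkc.mul (by fun_prop)).integrable_of_hasCompactSupport hk.2.mul_right
  have hB : (∫ w : ℝ, kf w * (((polyR pc (w / 2)) / 2 : ℝ) : ℂ)) =
      ∑ j ∈ range pc.length, ((((getV pc j : ℚ) : ℝ) / 2 ^ (j + 1) : ℝ) : ℂ) *
        ∑ i ∈ range (j + 1), (j.choose i : ℂ) *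
          (((a : ℂ) ^ i * M i) * ((-1) ^ (j - i) * conj ((a : ℂ) ^ (j - i) * M (j - i)))) := by
    have e : (fun w : ℝ ↦ kf w * (((polyR pc (w / 2)) / 2 : ℝ) : ℂ)) = fun w : ℝ ↦
        ∑ j ∈ range pc.length, ((((getV pc j : ℚ) : ℝ) / 2 ^ (j + 1) : ℝ) : ℂ) * (kf w * ((w ^ j : ℝ) : ℂ)) := by
      funext w; rw [half_polyR_half_cast, Finset.mul_sum]
      exact Finset.sum_congr rfl fun j _ ↦ by ring
    rw [e, integral_finsetSum _ fun j _ ↦ (hkpow j).const_mul _]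
    refine Finset.sum_congr rfl fun j _ ↦ ?_
    rw [integral_const_mul, hkf, integral_weilConv_weilReflect_mul_pow hg j]
    congr 1
    refine Finset.sum_congr rfl fun i _ ↦ ?_
    rw [integral_mul_pow_eq_weilMoment g hane, integral_weilReflect_mul_pow,
      integral_mul_pow_eq_weilMoment g hane]
  -- real part of (B), term by term
  set z : ℕ → ℕ → ℝ := fun k l ↦ (conj (M k) * M l).re with hz
  have hBre : (∫ w : ℝ, kf w * (((polyR pc (w / 2)) / 2 : ℝ) : ℂ)).re =
      ∑ j ∈ range pc.length, ∑ i ∈ range (j + 1), bonCoeff pc a i (j - i) * z i (j - i) := by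
    rw [hB, Complex.re_sum]
    refine Finset.sum_congr rfl fun j hj ↦ ?_
    rw [Finset.mul_sum, Complex.re_sum]
    refine Finset.sum_congr rfl fun i hi ↦ ?_
    have hij : i + (j - i) = j := by have := Finset.mem_range.1 hi; omega
    have e : ((((getV pc j : ℚ) : ℝ) / 2 ^ (j + 1) : ℝ) : ℂ) *
        ((j.choose i : ℂ) * (((a : ℂ) ^ i * M i) * ((-1) ^ (j - i) * conj ((a : ℂ) ^ (j - i) * M (j - i))))) =
        (((((getV pc j : ℚ) : ℝ) / 2 ^ (j + 1)) * (j.choose i : ℝ) * (-1) ^ (j - i) * a ^ j : ℝ) : ℂ) *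
          (M i * conj (M (j - i))) := by
      rw [map_mul, map_pow, Complex.conj_ofReal]
      push_cast
      rw [show (a : ℂ) ^ j = (a : ℂ) ^ i * (a : ℂ) ^ (j - i) by rw [← pow_add, hij]]
      ring
    rw [e, Complex.re_ofReal_mul, bonCoeff, hz]
    simp only
    rw [hij, ← WeilAna.re_mul_conj_eq]
  -- re-index (B) to the square
  have hsq : ∑ k ∈ range n, ∑ l ∈ range n, bonCoeff pc a k l * z k l =
      ∑ j ∈ range pc.length, ∑ i ∈ range (j + 1), bonCoeff pc a i (j - i) * z i (j - i) :=
    sum_range_sq_eq_sum_antidiag (fun k l ↦ bonCoeff pc a k l * z k l) hn fun k l hkl ↦ by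
      rw [bonCoeff, getV_eq_zero_of_length_le hkl]; simp
  -- assemble
  have hsplit : (∫ w : ℝ, kf w * (((1 / (2 * Real.cosh (w / 2)) : ℝ) : ℂ))) =
      (∫ w : ℝ, kf w * (((polyR pc (w / 2)) / 2 : ℝ) : ℂ)) + ∫ w : ℝ, kf w * ((r w : ℝ) : ℂ) := by
    have hi1 : Integrable fun w : ℝ ↦ kf w * (((polyR pc (w / 2)) / 2 : ℝ) : ℂ) := by
      refine (hkc.mul ?_).integrable_of_hasCompactSupport hk.2.mul_right
      refine Complex.continuous_ofReal.comp ?_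
      unfold polyR; fun_prop
    have hi2 : Integrable fun w : ℝ ↦ kf w * ((r w : ℝ) : ℂ) := by
      refine (hkc.mul ?_).integrable_of_hasCompactSupport hk.2.mul_right
      refine Complex.continuous_ofReal.comp ?_
      rw [hr]; unfold polyR
      refine Continuous.sub ?_ (by fun_prop)
      exact continuous_const.div (continuous_const.mul (Real.continuous_cosh.comp (by fun_prop)))
        fun w ↦ by positivity
    rw [← integral_add hi1 hi2]
    refine integral_congr_ae (Eventually.of_forall fun w ↦ ?_)
    simp only [hr]
    push_cast
    ring
  rw [hsplit, Complex.add_re, hBre, ← hsq]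
  have hre : -(2 * a * ε * N2) ≤ (∫ w : ℝ, kf w * ((r w : ℝ) : ℂ)).re := by
    have h1 := Complex.abs_re_le_norm (∫ w : ℝ, kf w * ((r w : ℝ) : ℂ))
    have h2 := neg_abs_le (∫ w : ℝ, kf w * ((r w : ℝ) : ℂ)).re
    linarith [hA]
  linarith

end Summit.Ventures.WeilGRH

end
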